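import Literature.AlgebraicGeometry.HodgeTheory.SemiregularVariationalHodgeTwistedPerfect
import Summits.HodgeConjecture.HodgeConjecture.Theorems.Ring2SemiregularRepresentativesLef
import Summits.HodgeConjecture.HodgeConjecture.Theorems.Ring2BindersAbelianSchemeVHCRaynaud
import Summits.Ventures.HSemireg.AmplificationChainSigmaGluable
import HarnessLib

/-!
# Road b02 — the TWISTED-PERFECT door wired to the landed chain (kernel glue for the twin crux of ruling A1)

research route conditional on HC_CM; not a corollary; Q11.4-sentence-2 already refuted in dim ≥ 3.

Support file for item stmt-HodgeConjecture-19779 (`Theses.VHCAbelianSchemesRoad.SemiregularSheafRepresentativesLefAt`) and for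
the LEAD's twin tenure edit (director-hodge ruling A1, 2026-08-25T22:39:44Z): the Literature definitions
`twistedReflexiveClass C Adm` (D1, `defn-twistedReflexiveClass`) and `TwistedPerfectDoorVHC C Adm` (D2, `defn-TwistedPerfectDoorVHC`)
of `Literature/AlgebraicGeometry/HodgeTheory/SemiregularVariationalHodgeTwistedPerfect.lean` (p418024) plugged BY NAME into the
door-agnostic chain of `Ring2SemiregularRepresentativesLef.lean` (`hc_av_of_lefAt`, `abelianSchemeVHC_of_lefAt`). THEOREMS ONLY
(no definition, no `sorry`, nothing asserted): (1) `TwistedPerfectDoorVHC C Adm ↔ LocalVariationalHodgeFor (twistedReflexiveClass C Adm)`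
is `Iff.rfl`; (2) the venture's `chPerfect` IS the Literature `chPerfect` (`rfl`) and `perfectObjClass C Adm ≤ twistedReflexiveClass C Adm`
(`B₀ = 0`); (3) `bfSheafClass C ≤ twistedReflexiveClass C Adm` for every notion `Adm ⊇ bfSingleAdmissible`, hence K-SR♭∃ for the sheaf
door implies K-SR♭∃ for the twisted door (`AdmissibleRepresentativesLefAt.mono`); (4) the twin `closes`-shape
`TwistedPerfectDoorVHC C Adm → AdmissibleRepresentativesLefAt (twistedReflexiveClass C Adm) → curve residual → André #21 → André #22 → HC_AV`
and its row-b02 form; (5) the twisted door's statement contains Buchweitz–Flenner's for `bfSheafClass C` (antitonicity). The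
admissibility notion `Adm` stays a parameter (Literature schema; intended: the venture's `gluableSigmaAdmissible`, or its
disjunction with `bfSingleAdmissible` when (3) is wanted); the route's items choose it.
-/

noncomputable section

open CategoryTheory AlgebraicGeometry
open Literature.AlgebraicGeometry Literature.AlgebraicGeometry.Motives
open Literature.AlgebraicGeometry.HodgeTheory
open Literature.AlgebraicGeometry.Andre1996 (andre1996_cmAnchoredPencil andre1996_cmHodgeClasses_algebraicallyAnchoredPencils)
open Summit.HodgeConjecture.HodgeConjecture.Ring2.Hypotheses (AbelianSchemeVHC)
open Summit.HodgeConjecture.HodgeConjecture.Ring2.Binders (OneParameterAbelianSchemeQuasiProjective)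
open Summit.Ventures.HSemireg (ObjClass LocalVariationalHodgeFor bfSheafClass perfectObjClass AdmissibilityNotion
  localVariationalHodgeFor_bfSheafClass)

namespace Summit.HodgeConjecture.HodgeConjecture.Ring2.SemiregularRepresentatives

-- the cell's namespace repeats the summit name (`Summit.HodgeConjecture.HodgeConjecture…`), as in every `Ring2*` file
set_option linter.dupNamespace false

variable (C : ChernCharacterBetti) (Adm : PerfectAdmissibility)

/-! ## §1 The Literature door is a door of the chain, by `rfl` -/

/-- **D2 IS the chain's local variational statement for the D1 class** (definitional unfolding, both sides being the
binders of `BuchweitzFlenner2003_variationalHodge_ISemiregular_model` at `𝒪 := twistedReflexiveClass C Adm`).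
[cite: BuchweitzFlenner2003, §5 Thm. 5.1 (binder shape)] -/
theorem twistedPerfectDoorVHC_iff_localVariationalHodgeFor :
    TwistedPerfectDoorVHC C Adm ↔ LocalVariationalHodgeFor (twistedReflexiveClass C Adm) :=
  Iff.rfl

/-- The Literature `PerfectAdmissibility` IS the venture's `AdmissibilityNotion` (same type), so venture notions such as
`gluableSigmaAdmissible` instantiate `Adm` directly. [folklore] -/
example : (Summit.Ventures.HSemireg.gluableSigmaAdmissible : PerfectAdmissibility) =
    Summit.Ventures.HSemireg.gluableSigmaAdmissible := rfl

/-- **The venture's Chern character of a bounded complex of vector bundles IS the Literature one** (same body: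
`chKZero (χ(E•))`). [cite: Fulton1998, §15.1] -/
theorem chPerfect_eq_literature (X : SchemeOver ℂ) (E : CochainComplex X.left.Modules ℤ)
    (hE : ∀ i, IsFiniteLocallyFree (E.X i)) (k : ℕ) :
    Summit.Ventures.HSemireg.chPerfect C X E hE k = HodgeTheory.chPerfect C X E hE k :=
  rfl

/-! ## §2 Inclusions of object classes -/

/-- **The venture's untwisted perfect door is inside the twisted door** (`B₀ = 0`), for the same notion `Adm`.
[cite: Perry2026Semiregularity, Thm. 1.1 (the case B₀ = 0)] -/
theorem perfectObjClass_le_twistedReflexiveClass (n : ℕ) (X₀ : SchemeOver ℂ) (I : Finset ℕ)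
    (κ : (p : ℕ) → complexBetti X₀ (2 * p)) (h : perfectObjClass C Adm n X₀ I κ) :
    twistedReflexiveClass C Adm n X₀ I κ := by
  obtain ⟨E, hE, hA, hκ⟩ := h
  exact twistedReflexiveClass_of_untwisted E hE hA hκ

variable {Adm} in
/-- **The sheaf door is inside the twisted door**: `bfSheafClass C ≤ twistedReflexiveClass C Adm` for every notion `Adm`
containing `bfSingleAdmissible` (an `I`-semiregular vector bundle in degree `0`, `B₀ = 0`).
[cite: BuchweitzFlenner2003, §5 (I-semiregular) and Thm. 5.1 (hypotheses)] -/
theorem bfSheafClass_le_twistedReflexiveClass (hAdm : ∀ n X₀ I E, bfSingleAdmissible n X₀ I E → Adm n X₀ I E) (n : ℕ)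
    (X₀ : SchemeOver ℂ) (I : Finset ℕ) (κ : (p : ℕ) → complexBetti X₀ (2 * p)) (h : bfSheafClass C n X₀ I κ) :
    twistedReflexiveClass C Adm n X₀ I κ := by
  obtain ⟨E₀, hE₀, hsr, hκ⟩ := h
  exact twistedReflexiveClass_of_isISemiregular hAdm E₀ hE₀ hsr hκ

variable {C Adm} in
/-- **K-SR♭∃ for the sheaf door ⟹ K-SR♭∃ for the twisted door** (monotonicity of `AdmissibleRepresentativesLefAt` in the door),
for every notion containing `bfSingleAdmissible`: a witness of crux 19779 at `C` is a witness of the twin crux at `C`.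
[cite: Bloch1972Semiregularity, Remark (7.5)] [cite: BuchweitzFlenner2003, §5 Thm. 5.1] -/
theorem admissibleRepresentativesLefAt_twisted_of_sheaf
    (hAdm : ∀ n X₀ I E, bfSingleAdmissible n X₀ I E → Adm n X₀ I E)
    (h : AdmissibleRepresentativesLefAt (bfSheafClass C)) :
    AdmissibleRepresentativesLefAt (twistedReflexiveClass C Adm) :=
  h.mono (bfSheafClass_le_twistedReflexiveClass C hAdm)

variable {C Adm} in
/-- The same for the every-fibre form K-SR♭. [cite: Bloch1972Semiregularity, Remark (7.5)] -/
theorem admissibleRepresentativesLef_twisted_of_sheaf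
    (hAdm : ∀ n X₀ I E, bfSingleAdmissible n X₀ I E → Adm n X₀ I E)
    (h : AdmissibleRepresentativesLef (bfSheafClass C)) :
    AdmissibleRepresentativesLef (twistedReflexiveClass C Adm) :=
  h.mono (bfSheafClass_le_twistedReflexiveClass C hAdm)

/-! ## §3 The twin `closes`-shape through `hc_av_of_lefAt` -/

variable {C Adm}

/-- **Twisted door + twisted K-SR♭∃ + curve residual + André 1996 ⟹ `HC_AV`** (the landed `hc_av_of_lefAt` at
`𝒪 := twistedReflexiveClass C Adm`, the door hypothesis being D2 by name). No `HC_CM`.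
[cite: Pridham2024Semiregularity, Rem. 2.26 with Cor. 2.25 and Rem. 2.27] [cite: Andre1996Motifs, §6.3 Lemmes 6.3.1–6.3.3] -/
theorem hc_av_of_twistedPerfectDoor_of_lefAt (hT : TwistedPerfectDoorVHC C Adm)
    (hSR : AdmissibleRepresentativesLefAt (twistedReflexiveClass C Adm)) (hqp : OneParameterAbelianSchemeQuasiProjective)
    (h₂₁ : andre1996_cmAnchoredPencil) (h₂₂ : andre1996_cmHodgeClasses_algebraicallyAnchoredPencils) :
    Theses.PadicSemiregularLift.HodgeAbelianVarieties :=
  hc_av_of_lefAt hT hSR hqp h₂₁ h₂₂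

/-- **Twisted door + twisted K-SR♭∃ + curve residual ⟹ row b02** (`AbelianSchemeVHC`), ring 2's exactness through node (U).
[cite: Pridham2024Semiregularity, Rem. 2.26 with Cor. 2.25 and Rem. 2.27] [cite: CharlesSchnell2014Notes, Prop. 11.3.11 (proof)] -/
theorem abelianSchemeVHC_of_twistedPerfectDoor_of_lefAt (hT : TwistedPerfectDoorVHC C Adm)
    (hSR : AdmissibleRepresentativesLefAt (twistedReflexiveClass C Adm)) (hqp : OneParameterAbelianSchemeQuasiProjective) :
    AbelianSchemeVHC :=
  abelianSchemeVHC_of_lefAt hT hSR hqp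

/-- **With Raynaud's fact in place of the curve residual** (the route's binder `RaynaudSectionProjective` by name).
[cite: Raynaud1970, Thm. XI 1.4] [cite: Andre1996Motifs, §6.3 Lemmes 6.3.1–6.3.3] -/
theorem hc_av_of_twistedPerfectDoor_of_lefAt_of_raynaud (hT : TwistedPerfectDoorVHC C Adm)
    (hSR : AdmissibleRepresentativesLefAt (twistedReflexiveClass C Adm))
    (hR : raynaud1970_abelianScheme_section_projective)
    (h₂₁ : andre1996_cmAnchoredPencil) (h₂₂ : andre1996_cmHodgeClasses_algebraicallyAnchoredPencils) :
    Theses.PadicSemiregularLift.HodgeAbelianVarieties :=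
  hc_av_of_lefAt hT hSR (Ring2.Binders.oneParameterAbelianSchemeQuasiProjective_of_raynaud1970 hR) h₂₁ h₂₂

/-! ## §4 Sanity: the twisted door's statement contains Buchweitz–Flenner's door for the sheaf class -/

/-- **`TwistedPerfectDoorVHC C Adm ⟹ LocalVariationalHodgeFor (bfSheafClass C)`** for `Adm ⊇ bfSingleAdmissible`
(antitonicity of the local variational statement in the object class). So taking D2 as a binder SUBSUMES taking BF Thm. 5.1
for the class `bfSheafClass C` at that `C`. [cite: BuchweitzFlenner2003, §5 Thm. 5.1] -/
theorem localVariationalHodgeFor_bfSheafClass_of_twistedPerfectDoor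
    (hAdm : ∀ n X₀ I E, bfSingleAdmissible n X₀ I E → Adm n X₀ I E) (hT : TwistedPerfectDoorVHC C Adm) :
    LocalVariationalHodgeFor (bfSheafClass C) :=
  LocalVariationalHodgeFor.anti (bfSheafClass_le_twistedReflexiveClass C hAdm) hT

end Summit.HodgeConjecture.HodgeConjecture.Ring2.SemiregularRepresentatives

end
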